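import Summits.CriticalPhenomena.CardyFormulaZ2.Theorems.CardySelfDualSegmentUniformMarginalityCrudeSandwich
import Summits.CriticalPhenomena.CardyFormulaZ2.Theorems.CardyBoundaryCoulombGasAssembly
import Summits.CriticalPhenomena.CardyFormulaZ2.Theorems.CardyMagicRigidityLoopsToCrossingsStubComparisonGeometry
import Literature.Topology.PlaneTopology.UniformLocalConnectedness

/-!
# The inner rectilinear approximant of a conformal rectangle (stub `stub_mixedApproximants`,
part 2)

Support file of the line `Sketch` for the crux `UniformMarginality` (stmt-CriticalPhenomena-5472,
route `CardySelfDualSegment`), second part of the stub `stub_mixedApproximants` (rectilinear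
inner/outer approximants of a conformal rectangle with nested crude crossing events).

* §1 Three geometric facts: opposite arcs of a conformal rectangle are a positive distance `g`
  apart (`exists_pos_le_dist_arc_zero_arc_two`, from `JordanDomain.exists_pos_le_dist_boundary`),
  the resulting bound `g ≤ infDist z arc₀ + infDist z arc₂`, and the **leash containment**
  `mem_carrier_of_forall_lt_dist`: if the boundary loop of `P` is pointwise `ρ`-close to that of
  `D`, every point of `D` farther than `ρ` from `∂D` lies in `P` (dog-on-leash for the index,
  `index_eq_index_of_dist_lt` of `CardyBoundaryCoulombGasAssemblySandwich.lean`).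
* §2 **The inner approximant** (`exists_innerApproximant`): the lower comparison quad `Q` of `R`
  (`exists_lowerQuad` of `CardyMagicRigidityLoopsToCrossingsStubComparisonGeometry.lean`, plate
  margin `g/4`) with room `r`, then the rectilinear approximant `R' := P` of `Q` with the same
  marks and a `min (ε/2) (r/2)`-close loop (`exists_rectilinear_close` of
  `CardyBoundaryCoulombGasRectilinearSufficesApprox.lean`), so `closure P ⊆ Q_{+r/2}` and
  `P.arc i ⊆ (Q.arc i)_{+r/2}` (`CardyBoundaryCoulombGasAssemblySandwich.lean`). The quad clauses
  put `(P, R)` in the mixed position of `crossEvent_subset_of_mixed`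
  (`CardySelfDualSegmentUniformMarginalityCrudeSandwich.lean`) with the pockets
  `F₀ = Q_{+r/2} ∖ R ∩ {infDist · arc₀ ≤ g/4}`, `F₂` likewise, `C₀ = arc₁ ∪ arc₂ ∪ arc₃`,
  `C₂ = arc₀ ∪ arc₁ ∪ arc₃`: the half room `r/2` and `∂R ⊆ closure R` convert the quad clauses on
  `Q_{+r} ∩ R` into the needed facts on `Q_{+r/2} ∩ ∂R`. Hence `crossEvent P δ ⊆ crossEvent R δ`
  for all small meshes and all lattice configurations.
-/

noncomputable section

namespace Summit.CriticalPhenomena.CardyFormulaZ2.Cruxes.UniformMarginality.HeatFlow.MixedApprox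

open Set Metric
open Literature.Probability.Percolation Literature.Probability.LatticeModels
  Literature.Probability.RandomPlanarGeometry
open Summit.CriticalPhenomena.CardyFormulaZ2.Theorems
open Summit.CriticalPhenomena.CardyFormulaZ2.Theorems.RectilinearApproximation
  (carrier_subset_cthickening_of_dist_boundary_le arc_subset_cthickening_of_dist_boundary_le)
open Summit.CriticalPhenomena.CardyFormulaZ2.Cruxes.LoopsToCrossings.OracleSandwich (exists_lowerQuad)

/-! ## §1 Opposite arcs; leash containment -/

/-- **Opposite arcs of a conformal rectangle are a positive distance apart** (the arcs `0` and
`2`; injectivity of the boundary loop on a period and compactness,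
`JordanDomain.exists_pos_le_dist_boundary`). -/
theorem exists_pos_le_dist_arc_zero_arc_two (R : ConformalRectangle) :
    ∃ g > 0, ∀ a ∈ R.arc 0, ∀ b ∈ R.arc 2, g ≤ dist a b := by
  obtain ⟨h0, h1, h2, h3, h4⟩ := R.marks_chain
  obtain ⟨n0, -, n2, -⟩ := R.nextMarks_eq
  have ha := min_le_left (R.mark 2 - R.mark 1) (R.mark 0 + 1 - R.mark 3)
  have hb := min_le_right (R.mark 2 - R.mark 1) (R.mark 0 + 1 - R.mark 3)
  obtain ⟨g, hg, hsep⟩ := R.toJordanDomain.exists_pos_le_dist_boundary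
    (τ := min (R.mark 2 - R.mark 1) (R.mark 0 + 1 - R.mark 3)) (lt_min (by linarith) (by linarith))
    (by linarith)
  refine ⟨g, hg, ?_⟩
  rintro _ ⟨θ, hθ, rfl⟩ _ ⟨φ, hφ, rfl⟩
  rw [n0] at hθ
  rw [n2] at hφ
  exact hsep θ φ (by linarith [hθ.2, hφ.1]) (by linarith [hθ.1, hφ.2])

/-- If two nonempty compact sets are `≥ g` apart then `g ≤ infDist z A + infDist z B` for every
point `z`. -/
theorem le_infDist_add_infDist {A B : Set ℂ} (hA : IsCompact A) (hB : IsCompact B)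
    (hAne : A.Nonempty) (hBne : B.Nonempty) {g : ℝ} (h : ∀ a ∈ A, ∀ b ∈ B, g ≤ dist a b) (z : ℂ) :
    g ≤ infDist z A + infDist z B := by
  obtain ⟨a, ha, had⟩ := hA.exists_infDist_eq_dist hAne z
  obtain ⟨b, hb, hbd⟩ := hB.exists_infDist_eq_dist hBne z
  rw [had, hbd, dist_comm z a]
  exact (h a ha b hb).trans (dist_triangle a z b)


/-- **Leash containment.** If the boundary loop of `P` is pointwise `ρ`-close to that of `D`, a
point of `D` at distance `> ρ` from every point of `∂D` lies in `P`: the two loops have the same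
(nonzero) index about it (`index_eq_index_of_dist_lt`), so it lies in `closure P`, and it is not
on `∂P` (which is within `ρ` of `∂D` pointwise). -/
theorem mem_carrier_of_forall_lt_dist (D P : JordanDomain) {ρ : ℝ}
    (h : ∀ u, dist (P.boundary u) (D.boundary u) ≤ ρ) {z : ℂ} (hz : z ∈ D.carrier)
    (hroom : ∀ w ∈ frontier D.carrier, ρ < dist z w) : z ∈ P.carrier := by
  have hzf : z ∉ frontier D.carrier := fun hzf => by
    have := hroom z hzf
    rw [dist_self] at this
    exact absurd (dist_nonneg.trans (h 0)) (not_le.2 this)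
  have hidx : P.index z = D.index z :=
    RectilinearApproximation.index_eq_index_of_dist_lt D P hzf fun t =>
      (h t).trans_lt (hroom _ (D.boundary_mem_frontier t))
  have hne : P.index z ≠ 0 := by rw [hidx]; exact D.index_ne_zero_of_mem_carrier hz
  have hcl : z ∈ closure P.carrier := by
    by_contra hout
    exact hne (P.index_eq_zero_of_mem_exterior hout)
  rw [closure_eq_self_union_frontier] at hcl
  rcases hcl with hP | hPf
  · exact hP
  · exfalso
    rw [← P.range_boundary] at hPf
    obtain ⟨u, rfl⟩ := hPf
    have h1 := h u
    have h2 := hroom _ (D.boundary_mem_frontier u)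
    linarith

/-- The frontier of a conformal rectangle off one arc lies in the union of the other three. -/
theorem frontier_diff_arc_subset (R : ConformalRectangle) (i : Fin 4) :
    frontier R.carrier \ R.arc i ⊆ ⋃ j ∈ ({j | j ≠ i} : Set (Fin 4)), R.arc j := by
  rintro z ⟨hz, hzi⟩
  rw [← (R.iUnion_arc_holds : ⋃ i, R.arc i = frontier R.carrier), mem_iUnion] at hz
  obtain ⟨j, hj⟩ := hz
  exact mem_biUnion (show j ∈ {j : Fin 4 | j ≠ i} from fun h => hzi (h ▸ hj)) hj

/-- Half room to full room: a point within `r/2` of the closed `r/2`-fattening of `S` lies in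
the closed `r`-fattening of `S`. -/
theorem mem_cthickening_of_half {S : Set ℂ} {r : ℝ} (hr : 0 < r) {z y : ℂ}
    (hz : z ∈ cthickening (r / 2) S) (hyz : dist y z < r / 2) : y ∈ cthickening r S := by
  have h1 := mem_cthickening_of_dist_le y z (r / 2) (cthickening (r / 2) S) hz hyz.le
  have h2 := cthickening_cthickening_subset (by positivity : (0 : ℝ) ≤ r / 2)
    (by positivity : (0 : ℝ) ≤ r / 2) S h1
  rwa [add_halves] at h2

/-! ## §2 The inner approximant -/

/-- **The inner rectilinear approximant.** For `ε > 0` a rectilinear conformal rectangle `R'`,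
`ε`-close to `R` in boundary loop and marks, whose crude crossing event is contained in that of
`R` for all small meshes and all lattice configurations (lower comparison quad, rectilinear
approximation with the same marks, mixed position, `crossEvent_subset_of_mixed`). -/
theorem exists_innerApproximant : ∀ (R : ConformalRectangle) (ε : ℝ), 0 < ε →
    ∃ R' : ConformalRectangle,
      (∃ S : Finset (ℂ × ℂ), (∀ p ∈ S, p.1.re = p.2.re ∨ p.1.im = p.2.im) ∧
        frontier R'.carrier ⊆ ⋃ p ∈ S, segment ℝ p.1 p.2) ∧
      (∀ u : ℝ, dist (R'.boundary u) (R.boundary u) ≤ ε) ∧ (∀ i : Fin 4, |R'.mark i - R.mark i| ≤ ε) ∧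
      ∃ δ₀ > 0, ∀ δ : ℝ, 0 < δ → δ < δ₀ → ∀ ω : BondConfig (Site 2), ω ⊆ (zdGraph 2).edgeSet →
        ω ∈ crossEvent R' δ → ω ∈ crossEvent R δ := by
  intro R ε hε
  obtain ⟨g, hg, hgap⟩ := exists_pos_le_dist_arc_zero_arc_two R
  have hsum : ∀ z, g ≤ infDist z (R.arc 0) + infDist z (R.arc 2) :=
    le_infDist_add_infDist (R.isCompact_arc 0) (R.isCompact_arc 2) ⟨_, R.pt_mem_arc_self 0⟩
      ⟨_, R.pt_mem_arc_self 2⟩ hgap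
  obtain ⟨m, hm, hQ⟩ := exists_lowerQuad R (ε₀ := ε / 2) (by positivity)
  obtain ⟨Q, r, hr, hQb, hQm, c3, c4, c5, c6⟩ := hQ (g / 4) (by positivity)
  obtain ⟨P, hPm, hPS, hPb⟩ := exists_rectilinear_close Q (ε := min (ε / 2) (r / 2))
    (lt_min (by positivity) (by positivity))
  have hρr : min (ε / 2) (r / 2) ≤ r / 2 := min_le_right _ _
  have hPQ : closure P.carrier ⊆ cthickening (r / 2) Q.carrier :=
    closure_minimal ((carrier_subset_cthickening_of_dist_boundary_le Q.toJordanDomain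
      P.toJordanDomain hPb).trans (cthickening_mono hρr _)) isClosed_cthickening
  have hParc : ∀ i, P.arc i ⊆ cthickening (r / 2) (Q.arc i) := fun i =>
    (arc_subset_cthickening_of_dist_boundary_le Q P hPb hPm i).trans (cthickening_mono hρr _)
  have hmono : ∀ S : Set ℂ, cthickening (r / 2) S ⊆ cthickening r S :=
    fun S => cthickening_mono (by linarith) S
  -- a frontier point of `R` in the half-fattening of `S` has points of `R` nearby in the fattening
  have hfr : ∀ {S : Set ℂ} {z : ℂ} {a : ℝ}, 0 < a → z ∈ cthickening (r / 2) S → z ∈ frontier R.carrier →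
      ∃ y ∈ R.carrier, y ∈ cthickening r S ∧ dist y z < a := by
    intro S z a ha hz hzf
    obtain ⟨y, hy, hyz⟩ := Metric.mem_closure_iff.1 (frontier_subset_closure hzf) (min a (r / 2))
      (lt_min ha (by positivity))
    rw [dist_comm] at hyz
    exact ⟨y, hy, mem_cthickening_of_half hr hz (hyz.trans_le (min_le_right _ _)),
      hyz.trans_le (min_le_left _ _)⟩
  -- the pockets and the closed sets
  set F0 : Set ℂ := cthickening (r / 2) Q.carrier ∩ R.carrierᶜ ∩ {z | infDist z (R.arc 0) ≤ g / 4}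
    with hF0
  set F2 : Set ℂ := cthickening (r / 2) Q.carrier ∩ R.carrierᶜ ∩ {z | infDist z (R.arc 2) ≤ g / 4}
    with hF2
  have hKc : IsCompact (cthickening (r / 2) Q.carrier ∩ R.carrierᶜ) :=
    (isCompact_of_isClosed_isBounded isClosed_cthickening Q.isBounded.cthickening).inter_right
      R.isOpen.isClosed_compl
  have hF0c : IsCompact F0 := hKc.inter_right (isClosed_le (continuous_infDist_pt _) continuous_const)
  have hF2c : IsCompact F2 := hKc.inter_right (isClosed_le (continuous_infDist_pt _) continuous_const)
  -- off `R`, on an arc of `R`, in the half-fattened quad: only on the arcs `0, 2`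
  have hnot13 : ∀ z ∈ cthickening (r / 2) Q.carrier, z ∉ R.arc 1 ∧ z ∉ R.arc 3 := by
    intro z hz
    constructor
    · intro hz1
      obtain ⟨y, hy, hyt, hyz⟩ := hfr hm hz (R.arc_subset_frontier 1 hz1)
      have := (c4 y hyt hy).1.trans (infDist_le_dist_of_mem hz1)
      linarith
    · intro hz3
      obtain ⟨y, hy, hyt, hyz⟩ := hfr hm hz (R.arc_subset_frontier 3 hz3)
      have := (c4 y hyt hy).2.trans (infDist_le_dist_of_mem hz3)
      linarith
  -- the fattened arcs `0, 2` of `Q` are off `closure R`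
  have hcap : ∀ (i : Fin 4) (z : ℂ), (∀ z ∈ cthickening r (Q.arc i), z ∉ R.carrier) →
      z ∈ cthickening (r / 2) (Q.arc i) → z ∉ closure R.carrier := by
    intro i z hci hz hzc
    rw [closure_eq_self_union_frontier] at hzc
    rcases hzc with hzR | hzf
    · exact hci z (hmono _ hz) hzR
    · obtain ⟨y, hy, hyt, -⟩ := hfr one_pos hz hzf
      exact hci y hyt hy
  refine ⟨P, hPS, fun u => ?_, fun i => ?_, ?_⟩
  · calc dist (P.boundary u) (R.boundary u)
        ≤ dist (P.boundary u) (Q.boundary u) + dist (Q.boundary u) (R.boundary u) := dist_triangle _ _ _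
      _ ≤ min (ε / 2) (r / 2) + ε / 2 := add_le_add (hPb u) (hQb u)
      _ ≤ ε := by linarith [min_le_left (ε / 2) (r / 2)]
  · rw [hPm i]; exact (hQm i).trans (by linarith)
  refine crossEvent_subset_of_mixed P R F0 F2 (R.arc 1 ∪ R.arc 2 ∪ R.arc 3) (R.arc 0 ∪ R.arc 1 ∪ R.arc 3)
    hF0c hF2c (((R.isClosed_arc 1).union (R.isClosed_arc 2)).union (R.isClosed_arc 3))
    (((R.isClosed_arc 0).union (R.isClosed_arc 1)).union (R.isClosed_arc 3))
    ?_ ?_ ?_ ?_ ?_ ?_ ?_ ?_ ?_ ?_ ?_ ?_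
  · -- closure P ⊆ R ∪ F0 ∪ F2
    intro z hz
    by_cases hzR : z ∈ R.carrier
    · exact Or.inl (Or.inl hzR)
    rcases c3 z (hmono _ (hPQ hz)) hzR with h | h
    · exact Or.inl (Or.inr ⟨⟨hPQ hz, hzR⟩, h⟩)
    · exact Or.inr ⟨⟨hPQ hz, hzR⟩, h⟩
  · exact Set.disjoint_left.2 fun z hz hzR => hz.1.2 hzR
  · exact Set.disjoint_left.2 fun z hz hzR => hz.1.2 hzR
  · refine Set.disjoint_left.2 fun z hz hz' => ?_
    have a : infDist z (R.arc 0) ≤ g / 4 := hz.2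
    have b : infDist z (R.arc 2) ≤ g / 4 := hz'.2
    linarith [hsum z]
  · -- frontier R ∖ arc 0 ⊆ C0
    intro z hz
    have := frontier_diff_arc_subset R 0 hz
    simp only [mem_iUnion, mem_setOf_eq, exists_prop] at this
    obtain ⟨j, hj, hzj⟩ := this
    fin_cases j
    · exact absurd rfl hj
    · exact Or.inl (Or.inl hzj)
    · exact Or.inl (Or.inr hzj)
    · exact Or.inr hzj
  · intro z hz
    have := frontier_diff_arc_subset R 2 hz
    simp only [mem_iUnion, mem_setOf_eq, exists_prop] at this
    obtain ⟨j, hj, hzj⟩ := this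
    fin_cases j
    · exact Or.inl (Or.inl hzj)
    · exact Or.inl (Or.inr hzj)
    · exact absurd rfl hj
    · exact Or.inr hzj
  · -- F0 off C0
    refine Set.disjoint_left.2 fun z hz hzC => ?_
    rcases hzC with (h1 | h2) | h3
    · exact (hnot13 z hz.1.1).1 h1
    · have := hsum z
      have a : infDist z (R.arc 0) ≤ g / 4 := hz.2
      rw [infDist_zero_of_mem h2] at this
      linarith
    · exact (hnot13 z hz.1.1).2 h3
  · refine Set.disjoint_left.2 fun z hz hzC => ?_
    rcases hzC with (h0 | h1) | h3
    · have := hsum z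
      have a : infDist z (R.arc 2) ≤ g / 4 := hz.2
      rw [infDist_zero_of_mem h0] at this
      linarith
    · exact (hnot13 z hz.1.1).1 h1
    · exact (hnot13 z hz.1.1).2 h3
  · exact Set.disjoint_left.2 fun z hz => hcap 0 z (fun w hw => (c5 w hw).1) (hParc 0 hz)
  · exact Set.disjoint_left.2 fun z hz => hcap 2 z (fun w hw => (c6 w hw).1) (hParc 2 hz)
  · refine Set.disjoint_left.2 fun z hz hz' => ?_
    have := (c5 z (hmono _ (hParc 0 hz))).2
    have b : infDist z (R.arc 2) ≤ g / 4 := hz'.2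
    linarith [hsum z]
  · refine Set.disjoint_left.2 fun z hz hz' => ?_
    have := (c6 z (hmono _ (hParc 2 hz))).2
    have b : infDist z (R.arc 0) ≤ g / 4 := hz'.2
    linarith [hsum z]

end Summit.CriticalPhenomena.CardyFormulaZ2.Cruxes.UniformMarginality.HeatFlow.MixedApprox

end
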